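import Summits.Ventures.HodgeRepro2.T5SU11KernelCompositionTwoSidedGlobalAll
import Summits.Ventures.HodgeRepro2.T5SU11KernelCompositionCorner
import Summits.Ventures.HodgeRepro2.T5SU11ResolventOrigin
import Summits.Ventures.HodgeRepro2.T5SU11KernelCompositionSymmetric

/-!
# Every composed kernel beyond the first extends continuously to the corner:
`K_λ^{∘(n+3)}(t, s) → ∫ χ_λ(r) (∫ χ_λ(u) K_λ^{∘(n+1)}(u, r) sinh 2u du) sinh 2r dr` as `(t, s) → (0, 0)`

Row 645 did it for `K_λ^{∘2}` (limit `∫ χ_λ² sinh 2r dr`). For the higher compositions the same dominated convergence applies to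
`K_λ^{∘(n+3)}(t, s) = ∫ K_λ(t, r) K_λ^{∘(n+2)}(r, s) sinh 2r dr` (row 649): the first factor is dominated by `Φ χ_λ(r)` (`t ≤ 1`, row 643)
and tends to `−χ_λ(r)`; the second is dominated by `C Ξ(r)` (row 649, uniformly in `s`) and, by the symmetry of row 582 and the
boundary value of row 625, tends to `−∫ χ_λ(u) K_λ^{∘(n+1)}(u, r) sinh 2u du` as `s → 0⁺`.

* `integrableOn_sphDecay_mul_sph_one_mul_sinh` — `χ_λ Ξ sinh 2r ∈ L¹(0, ∞)`;
* `tendsto_kernel_comp_corner_all` — **the joint limit of `K_λ^{∘(n+3)}` at the corner, for every `n`**: the corner values of all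
  composed kernels exist, recursively `⟨χ_λ, K_λ^{∘(n+1)} χ_λ⟩`.

Nothing is claimed about (N).

Blind lane: Mathlib + the HodgeRepro2 prefix only; no sorry; axioms ⊆ {propext, Classical.choice,
Quot.sound}.
-/

namespace Summit.Ventures.HodgeRepro2.T5SU11KernelCompositionCornerAll

open Filter Topology MeasureTheory
open Set (Ioi Ioc Icc)
open T5SU11Cartan T5SU11SphericalFunction T5SU11SphericalBounds T5SU11SphericalDecay T5SU11ReductionOfOrder
  T5SU11RadialGreenKernel T5SU11RadialGreenImproper T5SU11RadialGreenImproperOrigin T5SU11RadialGreenImproperDecaySource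
  T5SU11ResolventKernelComposition T5SU11ResolventTransformClass T5SU11ResolventNeumann T5SU11KernelDifferenceRegularity
  T5SU11ResolventGroundStateWeight T5SU11KernelCompositionSymmetric T5SU11KernelEnds T5SU11ResolventOrigin
  T5SU11ResolventOfDecaySolution T5SU11KernelCompositionTwoSidedGlobalAll

section measure

variable [MeasurableSpace Circle] [BorelSpace Circle]

variable {lam : ℝ} (hlam : 1 < lam)

include hlam in
/-- `χ_λ Ξ sinh 2r` is integrable on `(0, ∞)`. -/
theorem integrableOn_sphDecay_mul_sph_one_mul_sinh :
    IntegrableOn (fun r => sphDecay lam r * sph 1 (hyp r) * Real.sinh (2 * r)) (Ioi 0) := by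
  obtain ⟨hΞ, ⟨Φ, hΦ0, hΦ⟩, hεΞ, CΞ, hCΞ⟩ := sph_one_class hlam
  exact integrableOn_sphDecay_mul_mul_sinh hlam hΞ hΦ hΦ0 hεΞ (fun s hs => hCΞ s hs)

include hlam in
/-- The integrand `K_λ(t, r) K_λ^{∘(n+2)}(r, s) sinh 2r` is integrable on `(0, ∞)` for `t, s > 0`. -/
theorem integrableOn_kernel_mul_kernel_comp_mul_sinh (n : ℕ) {t s : ℝ} (ht : 0 < t) (hs : 0 < s) :
    IntegrableOn (fun r => sphGreenKernel lam t r
      * ((greenSolI (fun t => sph lam (hyp t)) (sphDecay lam))^[n + 1] (fun u => sphGreenKernel lam u s)) r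
      * Real.sinh (2 * r)) (Ioi 0) := by
  obtain ⟨Ms, hMs0, hMs⟩ := kernel_source_bounded hlam hs
  obtain ⟨Cs, s₀, hCs⟩ := kernel_source_decay hlam hs
  have hks := kernel_source_continuousOn hlam hs
  have hεk : 2 - lam < lam := by linarith
  obtain ⟨hck, ⟨Mk, hMk0, hMk⟩, hdk⟩ := iterate_class (lam₂ := lam) hlam hks hMs hMs0 hεk hCs (n + 1)
  obtain ⟨Kk, Tk, _, _, hKk⟩ := hdk ((1 + lam) / 2) (by rw [min_self]; linarith)
  have hε : 2 - lam < (1 + lam) / 2 := by linarith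
  have hB := integrableOn_sph_mul_mul_sinh_Ioc hck hMk hMk0 lam
  have hA := integrableOn_sphDecay_mul_mul_sinh hlam hck hMk hMk0 hε hKk
  exact integrableOn_kernel_mul hB hA ht

include hlam in
/-- **EVERY COMPOSED KERNEL BEYOND THE FIRST EXTENDS CONTINUOUSLY TO THE CORNER**:
`K_λ^{∘(n+3)}(t, s) → ∫ χ_λ(r) (∫ χ_λ(u) K_λ^{∘(n+1)}(u, r) sinh 2u du) sinh 2r dr` as `(t, s) → (0⁺, 0⁺)`. -/
theorem tendsto_kernel_comp_corner_all (n : ℕ) :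
    Tendsto (fun p : ℝ × ℝ =>
        ((greenSolI (fun t => sph lam (hyp t)) (sphDecay lam))^[n + 2] (fun u => sphGreenKernel lam u p.2)) p.1)
      (𝓝[>] 0 ×ˢ 𝓝[>] 0)
      (𝓝 (∫ r in Ioi 0, sphDecay lam r
        * (∫ u in Ioi 0, sphDecay lam u
            * ((greenSolI (fun t => sph lam (hyp t)) (sphDecay lam))^[n] (fun v => sphGreenKernel lam v r)) u
            * Real.sinh (2 * u))
        * Real.sinh (2 * r))) := by
  obtain ⟨Φ, hΦ0, hΦ⟩ := exists_sph_hyp_le lam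
  obtain ⟨C, hC, hC'⟩ := exists_abs_kernel_comp_le_mul_sph_one_all hlam
  -- the dominating function `Φ C Ξ(r)... χ_λ(r) Ξ(r) sinh 2r/(λ−1)^{2n}`
  set D := Φ * (C / ((lam - 1) ^ 2) ^ n) with hD
  have hD0 : 0 ≤ D := by positivity
  have hbound : Integrable (fun r => D * (sphDecay lam r * sph 1 (hyp r) * Real.sinh (2 * r))) (volume.restrict (Ioi 0)) :=
    (integrableOn_sphDecay_mul_sph_one_mul_sinh hlam).const_mul D
  have hsq : ∀ᶠ p : ℝ × ℝ in 𝓝[>] 0 ×ˢ 𝓝[>] 0, 0 < p.1 ∧ p.1 ≤ 1 ∧ 0 < p.2 ∧ p.2 ≤ 1 := by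
    filter_upwards [Filter.prod_mem_prod (Ioc_mem_nhdsGT one_pos) (Ioc_mem_nhdsGT one_pos)] with p hp
    exact ⟨hp.1.1, hp.1.2, hp.2.1, hp.2.2⟩
  -- rewrite the composed kernel as the integral
  have hrw : ∀ᶠ p : ℝ × ℝ in 𝓝[>] 0 ×ˢ 𝓝[>] 0,
      ((greenSolI (fun t => sph lam (hyp t)) (sphDecay lam))^[n + 2] (fun u => sphGreenKernel lam u p.2)) p.1
        = ∫ r in Ioi 0, sphGreenKernel lam p.1 r
          * ((greenSolI (fun t => sph lam (hyp t)) (sphDecay lam))^[n + 1] (fun u => sphGreenKernel lam u p.2)) r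
          * Real.sinh (2 * r) := by
    filter_upwards [hsq] with p hp
    exact kernel_comp_succ_eq_integral hlam n hp.1 hp.2.2.1
  have hmeas : ∀ᶠ p : ℝ × ℝ in 𝓝[>] 0 ×ˢ 𝓝[>] 0, AEStronglyMeasurable
      (fun r => sphGreenKernel lam p.1 r
        * ((greenSolI (fun t => sph lam (hyp t)) (sphDecay lam))^[n + 1] (fun u => sphGreenKernel lam u p.2)) r
        * Real.sinh (2 * r)) (volume.restrict (Ioi 0)) := by
    filter_upwards [hsq] with p hp
    exact (integrableOn_kernel_mul_kernel_comp_mul_sinh hlam n hp.1 hp.2.2.1).aestronglyMeasurable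
  have hdom : ∀ᶠ p : ℝ × ℝ in 𝓝[>] 0 ×ˢ 𝓝[>] 0, ∀ᵐ r ∂(volume.restrict (Ioi 0)),
      ‖sphGreenKernel lam p.1 r
        * ((greenSolI (fun t => sph lam (hyp t)) (sphDecay lam))^[n + 1] (fun u => sphGreenKernel lam u p.2)) r
        * Real.sinh (2 * r)‖ ≤ D * (sphDecay lam r * sph 1 (hyp r) * Real.sinh (2 * r)) := by
    filter_upwards [hsq] with p hp
    refine ae_restrict_of_forall_mem measurableSet_Ioi fun r hr => ?_
    have hr' : (0 : ℝ) < r := hr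
    have h1 := abs_kernel_le_mul_sphDecay_of_le_one hlam hΦ hp.1 hp.2.1 hr'
    have h2 := hC' n r p.2 hr' hp.2.2.1
    have hΞs : sph 1 (hyp p.2) ≤ 1 := sph_hyp_le_one zero_le_one one_le_two p.2
    have hΞs0 : 0 < sph 1 (hyp p.2) := sph_hyp_pos 1 p.2
    have hΞr0 : 0 < sph 1 (hyp r) := sph_hyp_pos 1 r
    have hCn : 0 ≤ C / ((lam - 1) ^ 2) ^ n := by positivity
    have h2' : |((greenSolI (fun t => sph lam (hyp t)) (sphDecay lam))^[n + 1] (fun u => sphGreenKernel lam u p.2)) r|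
        ≤ C / ((lam - 1) ^ 2) ^ n * sph 1 (hyp r) := by
      calc _ ≤ C / ((lam - 1) ^ 2) ^ n * sph 1 (hyp r) * sph 1 (hyp p.2) := h2
        _ ≤ C / ((lam - 1) ^ 2) ^ n * sph 1 (hyp r) * 1 :=
            mul_le_mul_of_nonneg_left hΞs (mul_nonneg hCn hΞr0.le)
        _ = C / ((lam - 1) ^ 2) ^ n * sph 1 (hyp r) := mul_one _
    have hsh : 0 ≤ Real.sinh (2 * r) := (sinh_two_mul_pos hr').le
    have hχ : 0 ≤ sphDecay lam r := (sphDecay_pos hlam hr').le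
    rw [Real.norm_eq_abs, abs_mul, abs_mul, abs_of_nonneg hsh]
    calc |sphGreenKernel lam p.1 r|
          * |((greenSolI (fun t => sph lam (hyp t)) (sphDecay lam))^[n + 1] (fun u => sphGreenKernel lam u p.2)) r|
          * Real.sinh (2 * r)
        ≤ (Φ * sphDecay lam r) * (C / ((lam - 1) ^ 2) ^ n * sph 1 (hyp r)) * Real.sinh (2 * r) :=
          mul_le_mul_of_nonneg_right (mul_le_mul h1 h2' (abs_nonneg _) (mul_nonneg hΦ0.le hχ)) hsh
      _ = D * (sphDecay lam r * sph 1 (hyp r) * Real.sinh (2 * r)) := by rw [hD]; ring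
  have hlim : ∀ᵐ r ∂(volume.restrict (Ioi 0)), Tendsto
      (fun p : ℝ × ℝ => sphGreenKernel lam p.1 r
        * ((greenSolI (fun t => sph lam (hyp t)) (sphDecay lam))^[n + 1] (fun u => sphGreenKernel lam u p.2)) r
        * Real.sinh (2 * r))
      (𝓝[>] 0 ×ˢ 𝓝[>] 0)
      (𝓝 (sphDecay lam r
        * (∫ u in Ioi 0, sphDecay lam u
            * ((greenSolI (fun t => sph lam (hyp t)) (sphDecay lam))^[n] (fun v => sphGreenKernel lam v r)) u
            * Real.sinh (2 * u))
        * Real.sinh (2 * r))) := by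
    refine ae_restrict_of_forall_mem measurableSet_Ioi fun r hr => ?_
    have hr' : (0 : ℝ) < r := hr
    have h1 : Tendsto (fun p : ℝ × ℝ => sphGreenKernel lam p.1 r) (𝓝[>] 0 ×ˢ 𝓝[>] 0) (𝓝 (-sphDecay lam r)) :=
      (tendsto_kernel_nhdsGT_zero lam hr').comp tendsto_fst
    have h2 : Tendsto (fun p : ℝ × ℝ =>
        ((greenSolI (fun t => sph lam (hyp t)) (sphDecay lam))^[n + 1] (fun u => sphGreenKernel lam u p.2)) r)
        (𝓝[>] 0 ×ˢ 𝓝[>] 0)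
        (𝓝 (-∫ u in Ioi 0, sphDecay lam u
            * ((greenSolI (fun t => sph lam (hyp t)) (sphDecay lam))^[n] (fun v => sphGreenKernel lam v r)) u
            * Real.sinh (2 * u))) := by
      have := (tendsto_kernel_comp_nhdsGT_zero hlam hr' n).comp (tendsto_snd (f := 𝓝[>] (0 : ℝ)) (g := 𝓝[>] (0 : ℝ)))
      refine this.congr' ?_
      filter_upwards [Filter.prod_mem_prod (self_mem_nhdsWithin) (self_mem_nhdsWithin)] with p hp
      simp only [Function.comp]
      exact (kernel_comp_symm hlam (n + 1) hr' hp.2).symm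
    have := (h1.mul h2).mul_const (Real.sinh (2 * r))
    simpa only [neg_mul_neg] using this
  have h := tendsto_integral_filter_of_dominated_convergence _ hmeas hdom hbound hlim
  exact h.congr' (hrw.mono fun p hp => hp.symm)

end measure

end Summit.Ventures.HodgeRepro2.T5SU11KernelCompositionCornerAll
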